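import Summits.BirchSwinnertonDyer.BirchSwinnertonDyer.Theorems.ByReductionTypeAtTwoRankOneAtTwoOneDoorLawSubsliceDefs
import Summits.BirchSwinnertonDyer.BirchSwinnertonDyer.Theorems.ByReductionTypeAtTwoRankOneAtTwoBigImageOddLocalOneDoorSubsliceDescentBits
import Summits.BirchSwinnertonDyer.BirchSwinnertonDyer.Theorems.ByReductionTypeAtTwoRankOneAtTwoBigImageOddLocalOneDoorManin
import HarnessLib

/-!
# Route ByReductionTypeAtTwo, crux `RankOneAtTwoBigImageOddLocal` (stmt-BirchSwinnertonDyer-23715), LINE v8.16 `one_door_analytic`: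
# THE RESIDUE R₊₊ SPLIT BY MECHANISM — `Ш(W)[2] ≠ 0` ⊔ `Δ_W > 0` non-egg ⊔ no odd-constant datum (`4 ∣ N`) — LOSSLESSLY, modulo print

Width prover seat `bsd-line-fkl-p2` g14 (2026-08-28), `--supports stmt-BirchSwinnertonDyer-23715` (helper).  THEOREMS ONLY (no definition, no named
fact introduced, no `sorry`).  BSD is not proved by any of this; every statement is CONDITIONAL by design (hypotheses: the five PRINT named facts of the
line — Gross–Zagier `gross_zagier`, Kolyvagin `kolyvagin`, modularity `exists_isNewformOf`, Hoffstein–Luo `HoffsteinLuo1997_exists_twist_L_one_ne_zero`,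
Gross 1991 Prop. 3.7 (2) — and the PRINT Manin bundle `S_maninPub` = modularity ∧ Abbes–Ullmo ∧ Česnavičius; nothing conjectural is asserted).

Setting.  The lead's APPEND #11 (`Theorems/…OneDoorLawSubsliceDefs.lean`) registers for skeleton v8.16 the residue
R₊₊ `DoorIndexLawFullCAtTwoSomeDoorResiduePlusPlus`: a lawful door datum for every curve of the slice WITHOUT a bottom-rung door datum that is neither in the
R⁻₀ class {`Δ_W < 0`, `Ш(W)[2] = 0`, odd-constant datum} nor in the egg class {`Δ_W > 0`, `Ш(W)[2] = 0`, `MeetsEgg`, odd-constant datum}.  Its docstring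
READS the population as «`Ш(W)[2] ≠ 0`, or `Δ_W > 0` with `E(ℚ) ⊂ E⁰(ℝ)`, or no odd-constant datum».  This file makes that reading a KERNEL THEOREM and
splits R₊₊ accordingly into three statements, one per planner mechanism, each spelled out (no new `def`; a lead's Defs APPEND may name them as stubs):

* R_S  («24882-type», Kolyvagin exactness at `2` beyond the first layer): every curve of the slice with `Ш(W)[2] ≠ 0` has a lawful door datum;
* R_N  («24883-type», the `Δ_W > 0` residual off the egg locus, -an's `η_f = 0`): every curve of the slice with `Δ_W > 0`, `Ш(W)[2] = 0`, `E(ℚ) ⊂ E⁰(ℝ)`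
  has a lawful door datum;
* R_A  (the `2`-primary Manin question at additive level): every curve of the slice with `4 ∣ N_W`, `Ш(W)[2] = 0`, NO odd-constant datum and no
  bottom-rung door datum has a lawful door datum.
On the first two populations the residue's hypothesis `¬ HasBottomRungDoorAtTwo W` is AUTOMATIC modulo print (g13's `not_hasBottomRungDoorAtTwo_of_not_shaTwoTrivial`
/ `…_of_not_meetsEgg`), so it is dropped from R_S and R_N; on the third, «no odd-constant datum» forces `4 ∣ N_W` by Abbes–Ullmo / Česnavičius
(`exists_modularParametrizationData_not_two_dvd`), so the population lies in the additive-at-`2` stratum `v₂(N) ≥ 2`.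

* §1 `residuePlusPlus_population` — the trichotomy at a curve satisfying R₊₊'s hypotheses (modulo `S_maninPub`);
* §2 `doorIndexLawFullCAtTwoSomeDoorResiduePlusPlus_of_populations` — R_S ∧ R_N ∧ R_A ⟹ R₊₊ (modulo `S_maninPub`), and
  `…_of_populations_of_maninOddAdditiveLevel` — under the OPEN Manin residue `ManinOddAdditiveLevelAtTwo` the population A is EMPTY, so R_S ∧ R_N ⟹ R₊₊;
* §3 `population_sha_of_residuePlusPlus`, `population_nonEgg_of_residuePlusPlus` (modulo PRINT⁵), `population_additive_of_residuePlusPlus` (verbatim) — R₊₊ ⟹ each;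
* §4 `residuePlusPlus_iff_populations` — R₊₊ ⟺ R_S ∧ R_N ∧ R_A modulo PRINT⁵ + `S_maninPub`: the split is LOSSLESS.

References: [GrossLMS1991] §10, Conj. 1.2; [Kolyvagin1990] Thm. A; [Kramer1981] Prop. 6; [AbbesUllmo1996] Thm. A; [Cesnavicius2018] Thm. 1.2;
[MazurRubin2010] Cor. 3.4 (i).
-/

set_option autoImplicit false
-- the Theorems namespace of this sub repeats the summit name by design (D-0017 nested layout)
set_option linter.dupNamespace false

noncomputable section

open scoped Classical

namespace Summit.BirchSwinnertonDyer.BirchSwinnertonDyer.Theorems.RankOneAtTwoOneDoor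

open WeierstrassCurve Literature.NumberTheory.EllipticCurves Literature.NumberTheory.EllipticCurves.ModularForms
  Summit.BirchSwinnertonDyer.Rank1Residual.F1Sign2
  Summit.BirchSwinnertonDyer.Rank1Residual.F1Sign2.TranspositionDoor

/-! ### §1 The population of R₊₊ -/

/-- **No odd-constant datum forces `4 ∣ N_W`** (PRINT: modularity, Abbes–Ullmo 1996 Thm. A, Česnavičius 2018 Thm. 1.2 give an odd-constant datum of
level `N_W` whenever `4 ∤ N_W` and `ρ̄_{W,2}` is irreducible, i.e. `E(ℚ)[2] = 0`). [cite: AbbesUllmo1996, Thm. A] [cite: Cesnavicius2018, Thm. 1.2] -/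
theorem four_dvd_conductor_of_no_odd_datum (hPub : S_maninPub) (W : WeierstrassCurve ℚ) [W.IsElliptic] [W.IsGloballyMinimal]
    [NeZero (W.conductorNorm ℤ)] (hT : Odd W.torsionOrder) (hno : ¬ ∃ Dt : ModularParametrizationData W (W.conductorNorm ℤ), Odd Dt.c) :
    4 ∣ W.conductorNorm ℤ := by
  by_contra h4
  obtain ⟨Dt, hc⟩ := exists_modularParametrizationData_not_two_dvd hPub.1 hPub.2.1 hPub.2.2 W rfl h4
    (irr_two_of_noRationalTwoTorsion W (noRationalTwoTorsion_of_odd_torsionOrder W hT))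
  exact hno ⟨Dt, Int.not_even_iff_odd.mp fun h => hc (even_iff_two_dvd.mp h)⟩

/-- **THE POPULATION OF R₊₊ (trichotomy), modulo `S_maninPub`.**  A curve (odd torsion order) that is neither in the R⁻₀ class {`Δ_W < 0`, `Ш(W)[2] = 0`,
odd-constant datum} nor in the egg class {`Δ_W > 0`, `Ш(W)[2] = 0`, `MeetsEgg`, odd-constant datum} satisfies: `Ш(W)[2] ≠ 0`, OR `Δ_W > 0` with `Ш(W)[2] = 0`
and `E(ℚ) ⊂ E⁰(ℝ)`, OR `Ш(W)[2] = 0`, (`Δ_W < 0` or `MeetsEgg`), no odd-constant datum and hence `4 ∣ N_W`.  (`Δ_W ≠ 0` for an elliptic curve.)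
[cite: AbbesUllmo1996, Thm. A] [cite: Cesnavicius2018, Thm. 1.2] [cite: GrossLMS1991, §10] -/
theorem residuePlusPlus_population (hPub : S_maninPub) (W : WeierstrassCurve ℚ) [W.IsElliptic] [W.IsGloballyMinimal] [NeZero (W.conductorNorm ℤ)]
    (hT : Odd W.torsionOrder)
    (hneg : ¬ (W.Δ < 0 ∧ ShaTwoTrivial W ∧ ∃ Dt : ModularParametrizationData W (W.conductorNorm ℤ), Odd Dt.c))
    (hegg : ¬ (0 < W.Δ ∧ ShaTwoTrivial W ∧ MeetsEgg W ∧ ∃ Dt : ModularParametrizationData W (W.conductorNorm ℤ), Odd Dt.c)) :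
    ¬ ShaTwoTrivial W ∨ (0 < W.Δ ∧ ShaTwoTrivial W ∧ ¬ MeetsEgg W) ∨
      (ShaTwoTrivial W ∧ (W.Δ < 0 ∨ MeetsEgg W) ∧ (¬ ∃ Dt : ModularParametrizationData W (W.conductorNorm ℤ), Odd Dt.c) ∧
        4 ∣ W.conductorNorm ℤ) := by
  by_cases hSha : ShaTwoTrivial W
  · right
    rcases lt_or_gt_of_ne W.isUnit_Δ.ne_zero with hΔ | hΔ
    · have hno : ¬ ∃ Dt : ModularParametrizationData W (W.conductorNorm ℤ), Odd Dt.c := fun hDt => hneg ⟨hΔ, hSha, hDt⟩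
      exact Or.inr ⟨hSha, Or.inl hΔ, hno, four_dvd_conductor_of_no_odd_datum hPub W hT hno⟩
    · by_cases hme : MeetsEgg W
      · have hno : ¬ ∃ Dt : ModularParametrizationData W (W.conductorNorm ℤ), Odd Dt.c := fun hDt => hegg ⟨hΔ, hSha, hme, hDt⟩
        exact Or.inr ⟨hSha, Or.inr hme, hno, four_dvd_conductor_of_no_odd_datum hPub W hT hno⟩
      · exact Or.inl ⟨hΔ, hSha, hme⟩
  · exact Or.inl hSha

/-! ### §2 R₊₊ from the three populations -/

/-- **R_S ∧ R_N ∧ R_A ⟹ R₊₊ (modulo `S_maninPub`).**  With R_S (lawful door for every curve of the slice with `Ш(W)[2] ≠ 0`), R_N (for every curve with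
`Δ_W > 0`, `Ш(W)[2] = 0`, `E(ℚ) ⊂ E⁰(ℝ)`) and R_A (for every curve with `4 ∣ N_W`, `Ш(W)[2] = 0`, no odd-constant datum, no bottom-rung door datum), the
v8.16 residue `DoorIndexLawFullCAtTwoSomeDoorResiduePlusPlus` follows by the trichotomy of §1.  CONDITIONAL by design; nothing is asserted about R_S, R_N,
R_A (conjecture-grade: route GenusKolyvaginAtTwo's 24882 / 24883 and the `2`-primary Manin question). [cite: GrossLMS1991, Conj. 1.2, §3 and §10]
[cite: Kolyvagin1990, Thm. A] [cite: Cesnavicius2018, Thm. 1.2] -/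
theorem doorIndexLawFullCAtTwoSomeDoorResiduePlusPlus_of_populations (hPub : S_maninPub)
    (hS : ∀ (W : WeierstrassCurve ℚ) [W.IsElliptic] [W.IsGloballyMinimal] [NeZero (W.conductorNorm ℤ)],
      ¬ W.HasCM → (∀ n : ℕ, W.HasSurjectiveModNGaloisRep ((2 ^ n : ℕ) : ℤ)) → Odd W.torsionOrder → Odd W.tamagawaProduct →
      W.analyticRank = 1 → ¬ ShaTwoTrivial W → HasLawfulDoorAtTwo W)
    (hN : ∀ (W : WeierstrassCurve ℚ) [W.IsElliptic] [W.IsGloballyMinimal] [NeZero (W.conductorNorm ℤ)],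
      ¬ W.HasCM → (∀ n : ℕ, W.HasSurjectiveModNGaloisRep ((2 ^ n : ℕ) : ℤ)) → Odd W.torsionOrder → Odd W.tamagawaProduct →
      W.analyticRank = 1 → 0 < W.Δ → ShaTwoTrivial W → ¬ MeetsEgg W → HasLawfulDoorAtTwo W)
    (hA : ∀ (W : WeierstrassCurve ℚ) [W.IsElliptic] [W.IsGloballyMinimal] [NeZero (W.conductorNorm ℤ)],
      ¬ W.HasCM → (∀ n : ℕ, W.HasSurjectiveModNGaloisRep ((2 ^ n : ℕ) : ℤ)) → Odd W.torsionOrder → Odd W.tamagawaProduct →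
      W.analyticRank = 1 → 4 ∣ W.conductorNorm ℤ → ShaTwoTrivial W →
      (¬ ∃ Dt : ModularParametrizationData W (W.conductorNorm ℤ), Odd Dt.c) → ¬ HasBottomRungDoorAtTwo W → HasLawfulDoorAtTwo W) :
    DoorIndexLawFullCAtTwoSomeDoorResiduePlusPlus := by
  intro W _ _ _ hCM hsurj hT hc hr hoff hneg hegg
  rcases residuePlusPlus_population hPub W hT hneg hegg with hSha | ⟨hΔ, hSha, hme⟩ | ⟨hSha, -, hno, h4⟩
  · exact hS W hCM hsurj hT hc hr hSha
  · exact hN W hCM hsurj hT hc hr hΔ hSha hme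
  · exact hA W hCM hsurj hT hc hr h4 hSha hno hoff

/-- **Under the OPEN Manin residue `ManinOddAdditiveLevelAtTwo` the population A is EMPTY, so R_S ∧ R_N ⟹ R₊₊** (modulo `S_maninPub`): an odd-constant
datum then exists at every level (`s_manin_of`), contradicting «no odd-constant datum».  CONDITIONAL by design. [cite: Cesnavicius2018, Thm. 1.2]
[cite: GrossLMS1991, Conj. 1.2 and §10] -/
theorem doorIndexLawFullCAtTwoSomeDoorResiduePlusPlus_of_populations_of_maninOddAdditiveLevel (hPub : S_maninPub) (hAdd : ManinOddAdditiveLevelAtTwo)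
    (hS : ∀ (W : WeierstrassCurve ℚ) [W.IsElliptic] [W.IsGloballyMinimal] [NeZero (W.conductorNorm ℤ)],
      ¬ W.HasCM → (∀ n : ℕ, W.HasSurjectiveModNGaloisRep ((2 ^ n : ℕ) : ℤ)) → Odd W.torsionOrder → Odd W.tamagawaProduct →
      W.analyticRank = 1 → ¬ ShaTwoTrivial W → HasLawfulDoorAtTwo W)
    (hN : ∀ (W : WeierstrassCurve ℚ) [W.IsElliptic] [W.IsGloballyMinimal] [NeZero (W.conductorNorm ℤ)],
      ¬ W.HasCM → (∀ n : ℕ, W.HasSurjectiveModNGaloisRep ((2 ^ n : ℕ) : ℤ)) → Odd W.torsionOrder → Odd W.tamagawaProduct →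
      W.analyticRank = 1 → 0 < W.Δ → ShaTwoTrivial W → ¬ MeetsEgg W → HasLawfulDoorAtTwo W) :
    DoorIndexLawFullCAtTwoSomeDoorResiduePlusPlus := by
  refine doorIndexLawFullCAtTwoSomeDoorResiduePlusPlus_of_populations hPub hS hN ?_
  intro W _ _ _ _ _ hT _ _ _ _ hno _
  exfalso
  obtain ⟨Dt, hc2⟩ := s_manin_of hPub hAdd W (noRationalTwoTorsion_of_odd_torsionOrder W hT)
  exact hno ⟨Dt, Int.not_even_iff_odd.mp fun h => hc2 (even_iff_two_dvd.mp h)⟩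

/-! ### §3 The three populations from R₊₊ -/

section OfResiduePlusPlus

variable
  (hGZ : ∀ (N : ℕ) [NeZero N] (W : WeierstrassCurve ℚ) (K : Type) [Field K] [NumberField K], gross_zagier N W K)
  (hKo : ∀ (N : ℕ) [NeZero N] (W : WeierstrassCurve ℚ) (K : Type) [Field K] [NumberField K], kolyvagin N W K)
  (hnf : exists_isNewformOf) (hHL : HoffsteinLuo1997_exists_twist_L_one_ne_zero)
  (h37 : Literature.NumberTheory.EllipticCurves.GrossLMS1991.prop37_2_frobeniusCongruence)

include hGZ hKo hnf hHL h37

/-- **R₊₊ ⟹ R_S** (the `Ш(W)[2] ≠ 0` population), modulo the five printed facts: `Ш(W)[2] ≠ 0` puts `W` off the sub-slice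
(`not_hasBottomRungDoorAtTwo_of_not_shaTwoTrivial`) and outside both first-layer classes, so R₊₊ applies by name.  CONDITIONAL by design.
[cite: GrossLMS1991, §10 and Conj. 1.2] [cite: Kolyvagin1990, Thm. A] -/
theorem population_sha_of_residuePlusPlus (hPP : DoorIndexLawFullCAtTwoSomeDoorResiduePlusPlus)
    (W : WeierstrassCurve ℚ) [W.IsElliptic] [W.IsGloballyMinimal] [NeZero (W.conductorNorm ℤ)]
    (hCM : ¬ W.HasCM) (hsurj : ∀ n : ℕ, W.HasSurjectiveModNGaloisRep ((2 ^ n : ℕ) : ℤ)) (hT : Odd W.torsionOrder)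
    (hc : Odd W.tamagawaProduct) (hr : W.analyticRank = 1) (hSha : ¬ ShaTwoTrivial W) : HasLawfulDoorAtTwo W :=
  hPP W hCM hsurj hT hc hr (not_hasBottomRungDoorAtTwo_of_not_shaTwoTrivial hGZ hKo hnf hHL h37 W hCM hsurj hT hc hr hSha)
    (fun h => hSha h.2.1) (fun h => hSha h.2.1)

/-- **R₊₊ ⟹ R_N** (the `Δ_W > 0` non-egg population), modulo the five printed facts: `E(ℚ) ⊂ E⁰(ℝ)` at `Δ_W > 0` puts `W` off the sub-slice
(`not_hasBottomRungDoorAtTwo_of_not_meetsEgg`) and outside both classes (`Δ_W > 0`, non-egg).  (`Ш(W)[2] = 0` is not used.)  CONDITIONAL by design.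
[cite: Kramer1981, Prop. 6] [cite: GrossLMS1991, §10 and Conj. 1.2] -/
theorem population_nonEgg_of_residuePlusPlus (hPP : DoorIndexLawFullCAtTwoSomeDoorResiduePlusPlus)
    (W : WeierstrassCurve ℚ) [W.IsElliptic] [W.IsGloballyMinimal] [NeZero (W.conductorNorm ℤ)]
    (hCM : ¬ W.HasCM) (hsurj : ∀ n : ℕ, W.HasSurjectiveModNGaloisRep ((2 ^ n : ℕ) : ℤ)) (hT : Odd W.torsionOrder)
    (hc : Odd W.tamagawaProduct) (hr : W.analyticRank = 1) (hΔ : 0 < W.Δ) (hegg : ¬ MeetsEgg W) : HasLawfulDoorAtTwo W :=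
  hPP W hCM hsurj hT hc hr (not_hasBottomRungDoorAtTwo_of_not_meetsEgg hGZ hKo hnf hHL h37 W hCM hsurj hT hc hr hΔ hegg)
    (fun h => absurd h.1 (not_lt.mpr hΔ.le)) (fun h => hegg h.2.2.1)

end OfResiduePlusPlus

/-- **R₊₊ ⟹ R_A** (the no-odd-constant-datum population; verbatim specialisation: «no odd-constant datum» refutes both class conjunctions).
[cite: GrossLMS1991, Conj. 1.2 and §10] -/
theorem population_additive_of_residuePlusPlus (hPP : DoorIndexLawFullCAtTwoSomeDoorResiduePlusPlus)
    (W : WeierstrassCurve ℚ) [W.IsElliptic] [W.IsGloballyMinimal] [NeZero (W.conductorNorm ℤ)]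
    (hCM : ¬ W.HasCM) (hsurj : ∀ n : ℕ, W.HasSurjectiveModNGaloisRep ((2 ^ n : ℕ) : ℤ)) (hT : Odd W.torsionOrder)
    (hc : Odd W.tamagawaProduct) (hr : W.analyticRank = 1)
    (hno : ¬ ∃ Dt : ModularParametrizationData W (W.conductorNorm ℤ), Odd Dt.c) (hoff : ¬ HasBottomRungDoorAtTwo W) : HasLawfulDoorAtTwo W :=
  hPP W hCM hsurj hT hc hr hoff (fun h => hno h.2.2) (fun h => hno h.2.2.2)

/-! ### §4 The split is lossless -/

/-- **R₊₊ ⟺ R_S ∧ R_N ∧ R_A, modulo the five printed facts and `S_maninPub`** — the v8.16 residue IS the conjunction of its three mechanism-populations: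
Kolyvagin exactness beyond the first layer on {`Ш(W)[2] ≠ 0`} (route GenusKolyvaginAtTwo's 24882), the `Δ_W > 0` non-egg residual (24883 / `η_f = 0`), and
the `2`-primary Manin question on {`4 ∣ N_W`, no odd-constant datum}.  CONDITIONAL by design; BSD is not proved by this and nothing is asserted about the
three populations. [cite: GrossLMS1991, Conj. 1.2, §3 and §10] [cite: Kolyvagin1990, Thm. A] [cite: Kramer1981, Prop. 6] [cite: Cesnavicius2018, Thm. 1.2] -/
theorem residuePlusPlus_iff_populations
    (hGZ : ∀ (N : ℕ) [NeZero N] (W : WeierstrassCurve ℚ) (K : Type) [Field K] [NumberField K], gross_zagier N W K)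
    (hKo : ∀ (N : ℕ) [NeZero N] (W : WeierstrassCurve ℚ) (K : Type) [Field K] [NumberField K], kolyvagin N W K)
    (hnf : exists_isNewformOf) (hHL : HoffsteinLuo1997_exists_twist_L_one_ne_zero)
    (h37 : Literature.NumberTheory.EllipticCurves.GrossLMS1991.prop37_2_frobeniusCongruence) (hPub : S_maninPub) :
    DoorIndexLawFullCAtTwoSomeDoorResiduePlusPlus ↔
      ((∀ (W : WeierstrassCurve ℚ) [W.IsElliptic] [W.IsGloballyMinimal] [NeZero (W.conductorNorm ℤ)],
          ¬ W.HasCM → (∀ n : ℕ, W.HasSurjectiveModNGaloisRep ((2 ^ n : ℕ) : ℤ)) → Odd W.torsionOrder → Odd W.tamagawaProduct →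
          W.analyticRank = 1 → ¬ ShaTwoTrivial W → HasLawfulDoorAtTwo W) ∧
        (∀ (W : WeierstrassCurve ℚ) [W.IsElliptic] [W.IsGloballyMinimal] [NeZero (W.conductorNorm ℤ)],
          ¬ W.HasCM → (∀ n : ℕ, W.HasSurjectiveModNGaloisRep ((2 ^ n : ℕ) : ℤ)) → Odd W.torsionOrder → Odd W.tamagawaProduct →
          W.analyticRank = 1 → 0 < W.Δ → ShaTwoTrivial W → ¬ MeetsEgg W → HasLawfulDoorAtTwo W) ∧
        (∀ (W : WeierstrassCurve ℚ) [W.IsElliptic] [W.IsGloballyMinimal] [NeZero (W.conductorNorm ℤ)],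
          ¬ W.HasCM → (∀ n : ℕ, W.HasSurjectiveModNGaloisRep ((2 ^ n : ℕ) : ℤ)) → Odd W.torsionOrder → Odd W.tamagawaProduct →
          W.analyticRank = 1 → 4 ∣ W.conductorNorm ℤ → ShaTwoTrivial W →
          (¬ ∃ Dt : ModularParametrizationData W (W.conductorNorm ℤ), Odd Dt.c) → ¬ HasBottomRungDoorAtTwo W → HasLawfulDoorAtTwo W)) := by
  refine ⟨fun hPP => ⟨?_, ?_, ?_⟩, fun h => doorIndexLawFullCAtTwoSomeDoorResiduePlusPlus_of_populations hPub h.1 h.2.1 h.2.2⟩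
  · intro W _ _ _ hCM hsurj hT hc hr hSha
    exact population_sha_of_residuePlusPlus hGZ hKo hnf hHL h37 hPP W hCM hsurj hT hc hr hSha
  · intro W _ _ _ hCM hsurj hT hc hr hΔ _ hegg
    exact population_nonEgg_of_residuePlusPlus hGZ hKo hnf hHL h37 hPP W hCM hsurj hT hc hr hΔ hegg
  · intro W _ _ _ hCM hsurj hT hc hr _ _ hno hoff
    exact population_additive_of_residuePlusPlus hPP W hCM hsurj hT hc hr hno hoff

end Summit.BirchSwinnertonDyer.BirchSwinnertonDyer.Theorems.RankOneAtTwoOneDoor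

end
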